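import Summits.PneNP.PneNP.Theorems.ChebyshevTracialDesignGeneralPositionBudget

/-!
# Cell pnp-psdrank, route `ChebyshevTracialDesign`: KERNEL PILE-UP — a `y`-THIRD of the matchings are hit by more than a quarter of the heavy groups
# (crux `TracialDecayExp20`, stmt-PneNP-19878; eng g13, MEMO-13 §2 — the mass form of the general-position budget lemma)

Brick `…GeneralPositionBudget` (p552327) shows, under the (SNT-q)-existence hypothesis with heavy sub-weights, that `k` groups of cuts of
`x`-mass `≥ θ` each satisfy `k·Σ_M y_M < 2·Σ_M y_M·hit(M)` (`sum_mul_hits_gt`), `hit(M)` = the number of groups containing an active tight partner of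
`M` [cite: Rothvoss2017, §2 (PDF pp. 5–6): tight pairs `|δ(U) ∩ M| = 1`], and extracts ONE matching with `hit(M) > k/2` (`exists_hit_gt_half`). A
structure theorem for the dense cell (MEMO-14 §5(e)) needs the MASS form: since `hit ≤ k` pointwise, Markov's inequality turns the average statement
into
* **`sum_lt_three_mul_sum_quarter_hit`** — the matchings with `hit(M) > k/4` carry MORE THAN A THIRD of `y`: `Σ_M y_M < 3·Σ_{M : k < 4·hit(M)} y_M`;
* **`third_of_matchings_piled`** — the same under the (SNT-q) hypothesis directly (groups of mass `≥ θ`, `k ≥ 1`).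
With DISJOINT groups and a rank-one cut side (`…GeneralPositionBudget.mulVec_eq_zero_of_tight_rankOne`), each such `M` has `> k/4` active tight partners
taken from distinct groups, all of whose directions lie in `ker Y_M` [cite: BrietDadushPokutta2014, Thm. 6 (§3): `X_U Y_M = 0`] — the quantitative
'directions pile up in kernels, for a `y`-large set of matchings' premise.
Stature: support/instrument (finite combinatorics; no defs, axioms standard). WHAT THIS IS NOT: no structure theorem, no value bound, nothing on psd
rank, no P-vs-NP content. Supports stmt-PneNP-19878.
-/

set_option linter.dupNamespace false -- `Summit.PneNP.PneNP.…`: summit = sub-problem (D-0017)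

noncomputable section

namespace Summit.PneNP.PneNP.Theorems.ChebyshevTracialDesignKernelPileUp

open Finset Matrix Literature.Barriers.PneNP Literature.Combinatorics.Optimization
open Summit.PneNP.PneNP.Theorems.ChebyshevTracialDesignGeneralPositionBudget

variable {n : ℕ}

/-- **Markov step.** If `h : PMatch n → ℕ` is bounded by `k ≥ 1`, `y ≥ 0`, and `k·Σ y < 2·Σ y·h` (the double count of brick
`…GeneralPositionBudget`), then the matchings with `4·h(M) > k` carry more than a third of `y`: `Σ_M y_M < 3·Σ_{M : k < 4 h(M)} y_M`. [folklore] -/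
theorem sum_lt_three_mul_sum_quarter_hit (y : PMatch n → ℝ) (hy : ∀ M, 0 ≤ y M) (h : PMatch n → ℕ) {k : ℕ} (hk : 0 < k)
    (hle : ∀ M, h M ≤ k) (hcount : (k : ℝ) * ∑ M, y M < 2 * ∑ M, y M * (h M : ℝ)) :
    ∑ M, y M < 3 * ∑ M ∈ univ.filter (fun M => k < 4 * h M), y M := by
  classical
  set H := univ.filter (fun M : PMatch n => k < 4 * h M) with hH
  have hk' : (0 : ℝ) < k := by exact_mod_cast hk
  -- split `Σ y·h` over `H` and its complement
  have hsplit : ∑ M, y M * (h M : ℝ) =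
      ∑ M ∈ H, y M * (h M : ℝ) + ∑ M ∈ univ.filter (fun M => ¬ k < 4 * h M), y M * (h M : ℝ) := by
    rw [hH, sum_filter_add_sum_filter_not]
  have hsplitY : ∑ M, y M = ∑ M ∈ H, y M + ∑ M ∈ univ.filter (fun M => ¬ k < 4 * h M), y M := by
    rw [hH, sum_filter_add_sum_filter_not]
  -- on `H`: `h ≤ k`; off `H`: `4h ≤ k`
  have h1 : ∑ M ∈ H, y M * (h M : ℝ) ≤ (k : ℝ) * ∑ M ∈ H, y M := by
    rw [mul_sum]
    refine sum_le_sum fun M _ => ?_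
    have : (h M : ℝ) ≤ k := by exact_mod_cast hle M
    nlinarith [hy M]
  have h2 : ∑ M ∈ univ.filter (fun M => ¬ k < 4 * h M), y M * (h M : ℝ) ≤
      (k : ℝ) / 4 * ∑ M ∈ univ.filter (fun M => ¬ k < 4 * h M), y M := by
    rw [mul_sum]
    refine sum_le_sum fun M hM => ?_
    have hM' : 4 * h M ≤ k := not_lt.1 (mem_filter.1 hM).2
    have : 4 * (h M : ℝ) ≤ k := by exact_mod_cast hM'
    nlinarith [hy M]
  rw [hsplit] at hcount
  rw [hsplitY]
  set a := ∑ M ∈ H, y M with ha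
  set b := ∑ M ∈ univ.filter (fun M => ¬ k < 4 * h M), y M with hb
  rw [hsplitY] at hcount
  -- `k(a+b) < 2(k a + (k/4) b)` ⇒ `a + b < 3a`… after dividing by `k/2`
  have key : (k : ℝ) * (a + b) < 2 * ((k : ℝ) * a + (k : ℝ) / 4 * b) := lt_of_lt_of_le hcount (by linarith)
  nlinarith

/-- **A `y`-THIRD OF THE MATCHINGS ARE PILED.** Under the (SNT-q)-existence hypothesis with heavy sub-weights (threshold `θ`), `k ≥ 1` groups of cuts of
`x`-mass `≥ θ` each force the matchings hit by MORE THAN `k/4` of the groups to carry more than a third of `y`: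
`Σ_M y_M < 3·Σ_{M : k < 4·hit(M)} y_M`. (With disjoint groups and a rank-one cut side, each such `M` has `> k/4` active tight partners from distinct
groups, all with directions in `ker Y_M` — bricks `groups_lt_two_mul_of_incidence`, `mulVec_eq_zero_of_tight_rankOne`.)
[cite: Rothvoss2017, §2 (PDF pp. 5–6)] [cite: BrietDadushPokutta2014, Thm. 6 (§3)] -/
theorem third_of_matchings_piled (x : OddSet n → ℝ) (hx0 : ∀ U, 0 ≤ x U) (y : PMatch n → ℝ) (hy : ∀ M, 0 ≤ y M) {θ : ℝ}
    (hSNT : ∀ x' : OddSet n → ℝ, (∀ U, 0 ≤ x' U ∧ x' U ≤ x U) → θ ≤ ∑ U, x' U →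
      ∀ y' : PMatch n → ℝ, (∀ M, 0 ≤ y' M ∧ y' M ≤ y M) → ∑ M, y M ≤ 2 * ∑ M, y' M →
        ∃ U M, cc U M = 1 ∧ 0 < x' U ∧ 0 < y' M)
    {k : ℕ} (hk : 0 < k) (G : Fin k → Finset (OddSet n)) (hG : ∀ j, θ ≤ ∑ U ∈ G j, x U) :
    ∑ M, y M < 3 * ∑ M ∈ univ.filter (fun M : PMatch n =>
      k < 4 * (univ.filter fun j : Fin k => ∃ U ∈ G j, 0 < x U ∧ cc U M = 1).card), y M := by
  classical
  refine sum_lt_three_mul_sum_quarter_hit y hy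
    (fun M => (univ.filter fun j : Fin k => ∃ U ∈ G j, 0 < x U ∧ cc U M = 1).card) hk (fun M => ?_)
    (sum_mul_hits_gt x hx0 y hy hSNT hk G hG)
  exact (card_filter_le _ _).trans (by rw [card_univ, Fintype.card_fin])

end Summit.PneNP.PneNP.Theorems.ChebyshevTracialDesignKernelPileUp
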